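import Literature.MathematicalPhysics.PowerSystems.DVOCReducedNetworkLyapunov
import HarnessLib

/-!
# GridStability/Lyapunov/DvocReducedSublevel — compact sublevel sets of the printed dVOC Lyapunov
# function (19) and the zero set of its dissipation rate (static half of the Track-T sentence)

Cell `gridfusion` (LADDER-GRIDFUSION), `plan/PARTITION.md` §0 row `Lyapunov/` + A20 (RULING 18,
TRACK T, step T2); seat gridfusion-lyap-1 (g3). File 1 of 2: the STATIC facts about the printed
objects; the ODE sentence (sublevel invariance, attraction to `𝒮 ∩ 𝒜`, existence) is
`Lyapunov/DvocReducedRoa.lean`, which imports this file (both in namespace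
`Summit.Ventures.GridStability.Lyapunov.DvocReducedRoa`). INPUT = lit-2's Literature typing
`Literature/MathematicalPhysics/PowerSystems/DVOCReducedNetworkLyapunov.lean` (p475771: the reduced
dVOC network `W.field` (17) in phase-error form, the printed Lyapunov function `W.V α₁` (19), the
comparison function `W.psi κ₀` (21), and PROPOSITION 3 (25) `V̇ ≤ −α₁ ψ²` PROVED from the two
instance properties `W.DecreaseOnS c` (= (23), the conclusion of Lemma 2 / Condition 2) and
`W.PhaseErrorBound κ₀` (`‖(𝒦 − 𝓛)v‖ ≤ κ₀‖v‖_S`), both of which a Bench certificate discharges as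
ONE exact positive-semidefiniteness statement each (T3)). MODELLED column throughout, model = the
printed REDUCED-ORDER model (17) [cite: GrossEtAl2019, §IV-C eq. (17)]; nothing here says a
converter or a grid is stable. Contents:

* `contDiff_field`, `contDiff_V`, `continuous_psi`, `fderiv_V_field` — the field (17) and `V` (19)
  are `C¹` (polynomial), `ψ` is continuous, and `DV(v)·f(v)` IS the printed (26) `Vdot` (lit-2's
  curve-form `hasDerivWithinAt_V` read along the straight line `v + τ f(v)`);
* `isCompact_sublevel` — every sublevel set `{V ≤ c}` of (19) is compact for `η α α₁ > 0`,
  `v_k* > 0` (the quartic magnitude penalty alone confines each `‖v_k‖`: `nsq_le_of_V_le`,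
  `norm_le_of_V_le`) — the `𝒦∞` bound (24) in the form the invariance argument consumes;
* `V_zero`, `psi_eq_zero_iff`, `mem_target_of_psi_eq_zero`, `psi_eq_zero_of_mem_target`,
  `V_eq_zero_of_mem_target` — on `{V < V(0)}`, `V(0) = ½ η α α₁ Σ_k v_k*²`, the dissipation rate
  `α₁ ψ²` vanishes EXACTLY on the target set `𝒯 := 𝒮 ∩ 𝒜 = {v ∈ 𝒮 | ‖v_k‖² = v_k*² ∀k}`
  (written inline as `{v | W.InS v ∧ ∀ k, dvocNsq v k = W.vref k ^ 2}` — lit-2's zero set of `V`),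
  whereas the printed `ψ` vanishes on `𝒯 ∪ {0}`; the zero-voltage state `0` is an equilibrium of
  (17) (`field_zero`), which is why the sentence excludes the level `V(0)` — the print removes it by
  the measure-zero clause of its Theorem 1 instead [cite: GrossEtAl2019, Thm 1].

THREE COLUMNS. CERTIFIED (per instance, elsewhere): `DecreaseOnS c`, `PhaseErrorBound κ₀` with
rational `c, κ₀ > 0` — T3's Bench file. MODELLED: reduced-order model (17) = [GrossEtAl2019]
Assumption 1 (uniform `ℓ/r`), Condition 1 (consistent set-points, traded for the angles `θ*` by
Prop. 1), quasi-steady-state lines `i_o = i_o^s(v)`. VALIDATED: nothing. No definition, no named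
fact; standard axioms.
-/

noncomputable section

open Set Filter Metric Topology
open Literature.MathematicalPhysics.PowerSystems

namespace Summit.Ventures.GridStability.Lyapunov.DvocReducedRoa

variable {N : ℕ} (W : DvocReduced N)

/-! ### Regularity of the printed objects (polynomial field, polynomial `V`, continuous `ψ`) -/

/-- `‖v_k‖²` is continuous in the state. [folklore] -/
theorem continuous_nsq (k : Fin N) : Continuous fun v : DvocState N => dvocNsq v k := by
  unfold dvocNsq; fun_prop

/-- The reduced-order field (17) is `C¹` (it is polynomial). [cite: GrossEtAl2019, eq. (17)] -/
theorem contDiff_field : ContDiff ℝ 1 W.field := by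
  unfold DvocReduced.field DvocReduced.g₁ DvocReduced.g₂ DvocReduced.eθ₁ DvocReduced.eθ₂
    DvocReduced.Phi dvocNsq
  fun_prop

/-- The reduced-order field (17) is continuous. [cite: GrossEtAl2019, eq. (17)] -/
theorem continuous_field : Continuous W.field := (contDiff_field W).continuous

/-- The printed Lyapunov function (19) is `C¹` (it is polynomial). [cite: GrossEtAl2019, eq. (19)] -/
theorem contDiff_V (α₁ : ℝ) : ContDiff ℝ 1 (W.V α₁) := by
  unfold DvocReduced.V DvocReduced.normS2 DvocReduced.qS DvocReduced.sig₁ DvocReduced.sig₂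
    dvocDot dvocNsq
  fun_prop

/-- The printed Lyapunov function (19) is continuous. [cite: GrossEtAl2019, eq. (19)] -/
theorem continuous_V (α₁ : ℝ) : Continuous (W.V α₁) := (contDiff_V W α₁).continuous

/-- `‖v‖²_S` is continuous. [cite: GrossEtAl2019, eq. (22)] -/
theorem continuous_normS2 : Continuous W.normS2 := by
  unfold DvocReduced.normS2 DvocReduced.qS DvocReduced.sig₁ DvocReduced.sig₂ dvocDot
  fun_prop

/-- The comparison function `ψ` (21) is continuous. [cite: GrossEtAl2019, eq. (21)] -/
theorem continuous_psi (κ₀ : ℝ) : Continuous (W.psi κ₀) := by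
  have h1 := continuous_normS2 W
  have h2 : Continuous fun v : DvocState N => ∑ k, W.Phi v k ^ 2 * dvocNsq v k := by
    unfold DvocReduced.Phi dvocNsq; fun_prop
  unfold DvocReduced.psi
  fun_prop

/-- **The Fréchet derivative of (19) along (17) is the printed expression (26)**:
`DV(v) · f(v) = Vdot(v)` (lit-2's `hasDerivWithinAt_V` along the straight line `v + τ f(v)`,
uniqueness of derivatives). [cite: GrossEtAl2019, eq. (26)] -/
theorem fderiv_V_field (α₁ : ℝ) (x : DvocState N) :
    fderiv ℝ (W.V α₁) x (W.field x) = W.Vdot α₁ x := by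
  set γ : ℝ → DvocState N := fun τ => x + τ • W.field x with hγdef
  have hγ0 : γ 0 = x := by simp [hγdef]
  have hγ : HasDerivAt γ (W.field x) 0 := by
    have h := ((hasDerivAt_id (0 : ℝ)).smul_const (W.field x)).const_add x
    simpa [hγdef] using h
  have hVx : HasFDerivAt (W.V α₁) (fderiv ℝ (W.V α₁) x) (γ 0) := by
    rw [hγ0]; exact ((contDiff_V W α₁).differentiable one_ne_zero x).hasFDerivAt
  have h1 : HasDerivAt (fun τ => W.V α₁ (γ τ)) (fderiv ℝ (W.V α₁) x (W.field x)) 0 :=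
    hVx.comp_hasDerivAt 0 hγ
  have h2 : HasDerivAt (fun τ => W.V α₁ (γ τ)) (W.Vdot α₁ (γ 0)) 0 := by
    have h := W.hasDerivWithinAt_V α₁ (s := univ) (t := 0) (γ := γ)
      (by rw [hγ0]; exact hγ.hasDerivWithinAt)
    exact hasDerivWithinAt_univ.1 h
  rw [hγ0] at h2
  exact h1.unique h2

/-- **The zero-voltage state is an equilibrium of (17)** (`e_θ` is linear and `Φ(0)·0 = 0`): the
constant solution `v ≡ 0` never approaches `𝒮 ∩ 𝒜`, so an attraction statement must exclude it —
below by the level `V(0)` (`V_zero`); in print by the measure-zero clause of [GrossEtAl2019, Thm 1].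
[cite: GrossEtAl2019, §IV-C] -/
theorem field_zero : W.field 0 = 0 := by
  refine Prod.ext (funext fun k => ?_) (funext fun k => ?_) <;>
    simp [DvocReduced.field, DvocReduced.g₁, DvocReduced.g₂, DvocReduced.eθ₁, DvocReduced.eθ₂]

/-! ### Sublevel sets of (19) are compact -/

/-- **Magnitude confinement on a sublevel set**: if `η α α₁ > 0`, all `v_k* > 0` and `V(v) ≤ c`,
then every `‖v_k‖²` is at most the constant
`B(c) := Σ_j (v_j*² + (1 + (2c/(ηαα₁)) v_j*²)/2)` (from the penalty term alone:
`(v_k*² − ‖v_k‖²)² ≤ (2c/(ηαα₁)) v_k*²` and `2s ≤ 1 + s²`). [folklore] -/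
theorem nsq_le_of_V_le [NeZero N] (hv : ∀ k, 0 < W.vref k) {α₁ : ℝ} (hw : 0 < W.η * W.α * α₁)
    {c : ℝ} {v : DvocState N} (hc : W.V α₁ v ≤ c) (k : Fin N) :
    dvocNsq v k ≤ ∑ j, (W.vref j ^ 2 + (1 + 2 * c / (W.η * W.α * α₁) * W.vref j ^ 2) / 2) := by
  have hΛ : W.Lam ≠ 0 := (W.Lam_pos hv).ne'
  have hS := W.normS2_nonneg hΛ v
  have hterm : ∀ j, 0 ≤ (W.vref j ^ 2 - dvocNsq v j) ^ 2 / W.vref j ^ 2 := fun j => by positivity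
  -- the penalty sum is at most `2c/(ηαα₁)`
  have hP : ∑ j, (W.vref j ^ 2 - dvocNsq v j) ^ 2 / W.vref j ^ 2 ≤ 2 * c / (W.η * W.α * α₁) := by
    rw [le_div_iff₀ hw]
    unfold DvocReduced.V at hc
    nlinarith
  have hk : (W.vref k ^ 2 - dvocNsq v k) ^ 2 / W.vref k ^ 2 ≤ 2 * c / (W.η * W.α * α₁) :=
    (Finset.single_le_sum (fun j _ => hterm j) (Finset.mem_univ k)).trans hP
  have hvk : 0 < W.vref k ^ 2 := pow_pos (hv k) 2
  rw [div_le_iff₀ hvk] at hk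
  -- `2 s ≤ 1 + s²` with `s = ‖v_k‖² − v_k*²`
  have hone : dvocNsq v k ≤ W.vref k ^ 2 + (1 + 2 * c / (W.η * W.α * α₁) * W.vref k ^ 2) / 2 := by
    nlinarith [sq_nonneg (dvocNsq v k - W.vref k ^ 2 - 1)]
  have hnn : ∀ j, 0 ≤ W.vref j ^ 2 + (1 + 2 * c / (W.η * W.α * α₁) * W.vref j ^ 2) / 2 := by
    intro j
    have h0 : 0 ≤ 2 * c / (W.η * W.α * α₁) := by
      have hVn := W.V_nonneg hΛ hw.le v
      exact div_nonneg (by linarith) hw.le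
    positivity
  exact hone.trans (Finset.single_le_sum (fun j _ => hnn j) (Finset.mem_univ k))

/-- **Norm bound on a sublevel set**: `V(v) ≤ c ⇒ ‖v‖ ≤ √B(c)` (sup norm of the coordinate
model `(Fin N → ℝ) × (Fin N → ℝ)`). [folklore] -/
theorem norm_le_of_V_le [NeZero N] (hv : ∀ k, 0 < W.vref k) {α₁ : ℝ} (hw : 0 < W.η * W.α * α₁)
    {c : ℝ} {v : DvocState N} (hc : W.V α₁ v ≤ c) :
    ‖v‖ ≤ Real.sqrt (∑ j, (W.vref j ^ 2 + (1 + 2 * c / (W.η * W.α * α₁) * W.vref j ^ 2) / 2)) := by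
  set B := ∑ j, (W.vref j ^ 2 + (1 + 2 * c / (W.η * W.α * α₁) * W.vref j ^ 2) / 2) with hB
  have hk := nsq_le_of_V_le W hv hw hc
  have hR : 0 ≤ Real.sqrt B := Real.sqrt_nonneg _
  have h1 : ∀ k, |v.1 k| ≤ Real.sqrt B := fun k =>
    Real.abs_le_sqrt (by have := hk k; unfold dvocNsq at this; nlinarith [sq_nonneg (v.2 k)])
  have h2 : ∀ k, |v.2 k| ≤ Real.sqrt B := fun k =>
    Real.abs_le_sqrt (by have := hk k; unfold dvocNsq at this; nlinarith [sq_nonneg (v.1 k)])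
  rw [Prod.norm_def, max_le_iff, pi_norm_le_iff_of_nonneg hR, pi_norm_le_iff_of_nonneg hR]
  exact ⟨fun k => by rw [Real.norm_eq_abs]; exact h1 k, fun k => by rw [Real.norm_eq_abs]; exact h2 k⟩

/-- **Every sublevel set `{V ≤ c}` of (19) is compact** (`η α α₁ > 0`, all `v_k* > 0`): closed by
continuity, bounded by `norm_le_of_V_le`, and the state space is finite-dimensional. This is the
`𝒦∞` lower bound (24) of [GrossEtAl2019, Prop. 3] in the form the invariance argument consumes.
[cite: GrossEtAl2019, Prop. 3 (24)] -/
theorem isCompact_sublevel [NeZero N] (hv : ∀ k, 0 < W.vref k) {α₁ : ℝ}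
    (hw : 0 < W.η * W.α * α₁) (c : ℝ) : IsCompact {v : DvocState N | W.V α₁ v ≤ c} := by
  refine Metric.isCompact_of_isClosed_isBounded (isClosed_le (continuous_V W α₁) continuous_const) ?_
  refine (Metric.isBounded_closedBall (x := (0 : DvocState N))
    (r := Real.sqrt (∑ j, (W.vref j ^ 2 + (1 + 2 * c / (W.η * W.α * α₁) * W.vref j ^ 2) / 2)))).subset
    fun v hv' => ?_
  rw [mem_closedBall, dist_zero_right]
  exact norm_le_of_V_le W hv hw hv'

/-! ### The target set `𝒯 = 𝒮 ∩ 𝒜` and the zero set of the dissipation rate -/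

/-- Squared magnitudes on the synchronous set: `‖(S(a,b))_k‖² = v_k*² (a² + b²)`.
[cite: GrossEtAl2019, §IV-D] -/
theorem nsq_embS (a b : ℝ) (k : Fin N) :
    dvocNsq (W.embS a b) k = W.vref k ^ 2 * (a ^ 2 + b ^ 2) := by
  have sc := Real.sin_sq_add_cos_sq (W.θ k)
  simp only [dvocNsq, DvocReduced.embS]
  linear_combination (W.vref k ^ 2 * (a ^ 2 + b ^ 2)) * sc

/-- `S(0, 0) = 0`. [folklore] -/
theorem embS_zero : W.embS 0 0 = 0 := by
  refine Prod.ext (funext fun k => ?_) (funext fun k => ?_) <;> simp [DvocReduced.embS]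

/-- **The value of (19) at the zero-voltage state**: `V(0) = ½ η α α₁ Σ_k v_k*²` (`0 ∈ 𝒮`, so
`‖0‖_S = 0`, and every penalty term is `v_k*²`; all `v_k* ≠ 0`). [cite: GrossEtAl2019, eq. (19)] -/
theorem V_zero (hne : ∀ k, W.vref k ≠ 0) (hΛ : W.Lam ≠ 0) (α₁ : ℝ) :
    W.V α₁ 0 = 1 / 2 * W.η * W.α * α₁ * W.Lam := by
  have h0 : W.normS2 0 = 0 := by rw [← embS_zero W]; exact W.normS2_embS hΛ 0 0
  have h1 : ∑ k, (W.vref k ^ 2 - dvocNsq (0 : DvocState N) k) ^ 2 / W.vref k ^ 2 = W.Lam := by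
    unfold DvocReduced.Lam
    refine Finset.sum_congr rfl fun k _ => ?_
    have : dvocNsq (0 : DvocState N) k = 0 := by simp [dvocNsq]
    rw [this]
    field_simp [hne k]
    ring
  unfold DvocReduced.V
  rw [h0, h1]
  ring

/-- **Zero set of `ψ`** (`η, κ₀, α > 0`, `Λ ≠ 0`): `ψ(v) = 0 ↔ ‖v‖²_S = 0 ∧ ∀ k, Φ_k(v) = 0 ∨
‖v_k‖ = 0`. [cite: GrossEtAl2019, eq. (21)] -/
theorem psi_eq_zero_iff (hη : 0 < W.η) (hα : 0 < W.α) {κ₀ : ℝ} (hκ₀ : 0 < κ₀) (hΛ : W.Lam ≠ 0)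
    (v : DvocState N) :
    W.psi κ₀ v = 0 ↔ W.normS2 v = 0 ∧ ∀ k, W.Phi v k = 0 ∨ dvocNsq v k = 0 := by
  have hS0 := W.normS2_nonneg hΛ v
  have hn0 : ∀ k, 0 ≤ dvocNsq v k := fun k => by unfold dvocNsq; positivity
  have hB0 : 0 ≤ ∑ k, W.Phi v k ^ 2 * dvocNsq v k :=
    Finset.sum_nonneg fun k _ => mul_nonneg (sq_nonneg _) (hn0 k)
  have ha := Real.sqrt_nonneg (W.normS2 v)
  have hb := Real.sqrt_nonneg (∑ k, W.Phi v k ^ 2 * dvocNsq v k)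
  unfold DvocReduced.psi
  constructor
  · intro h
    have hab : κ₀ * Real.sqrt (W.normS2 v) + W.α * Real.sqrt (∑ k, W.Phi v k ^ 2 * dvocNsq v k)
        = 0 := by
      rcases mul_eq_zero.1 h with h' | h'
      · exact absurd h' hη.ne'
      · exact h'
    have h1 : Real.sqrt (W.normS2 v) = 0 := by nlinarith [mul_nonneg hκ₀.le ha, mul_nonneg hα.le hb]
    have h2 : Real.sqrt (∑ k, W.Phi v k ^ 2 * dvocNsq v k) = 0 := by
      nlinarith [mul_nonneg hκ₀.le ha, mul_nonneg hα.le hb]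
    rw [Real.sqrt_eq_zero hS0] at h1
    rw [Real.sqrt_eq_zero hB0] at h2
    refine ⟨h1, fun k => ?_⟩
    have hk := (Finset.sum_eq_zero_iff_of_nonneg fun j _ => mul_nonneg (sq_nonneg _) (hn0 j)).1 h2
      k (Finset.mem_univ k)
    rcases mul_eq_zero.1 hk with h' | h'
    · exact Or.inl (pow_eq_zero_iff (n := 2) (by norm_num) |>.1 h')
    · exact Or.inr h'
  · rintro ⟨h1, h2⟩
    have hsum : ∑ k, W.Phi v k ^ 2 * dvocNsq v k = 0 :=
      Finset.sum_eq_zero fun k _ => by rcases h2 k with h' | h' <;> simp [h']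
    rw [h1, hsum, Real.sqrt_zero]
    ring

/-- **`ψ = 0` below the level `V(0)` means `v ∈ 𝒮 ∩ 𝒜`**: if `ψ(v) = 0` then `v = S(a,b) ∈ 𝒮` and
each `‖v_k‖² = v_k*²(a² + b²)` is `0` or `v_k*²`, so `a² + b² ∈ {0, 1}`; the case `a² + b² = 0` is
`v = 0`, excluded by `V(v) < V(0)`. (`N ≥ 1`, `η, α, κ₀, v_k* > 0`.)
[cite: GrossEtAl2019, Prop. 3] -/
theorem mem_target_of_psi_eq_zero [NeZero N] (hη : 0 < W.η) (hα : 0 < W.α)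
    (hv : ∀ k, 0 < W.vref k) {α₁ κ₀ : ℝ} (hκ₀ : 0 < κ₀) {v : DvocState N}
    (hψ : W.psi κ₀ v = 0) (hV : W.V α₁ v < 1 / 2 * W.η * W.α * α₁ * W.Lam) :
    W.InS v ∧ ∀ k, dvocNsq v k = W.vref k ^ 2 := by
  have hΛ : W.Lam ≠ 0 := (W.Lam_pos hv).ne'
  have hne : ∀ k, W.vref k ≠ 0 := fun k => (hv k).ne'
  obtain ⟨hS, hk⟩ := (psi_eq_zero_iff W hη hα hκ₀ hΛ v).1 hψ
  have hIn : W.InS v := (W.normS2_eq_zero_iff hΛ v).1 hS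
  refine ⟨hIn, ?_⟩
  obtain ⟨a, b, rfl⟩ := hIn
  have k₀ : Fin N := ⟨0, Nat.pos_of_ne_zero (NeZero.ne N)⟩
  have hr : a ^ 2 + b ^ 2 = 1 := by
    rcases hk k₀ with h | h
    · -- `Φ_{k₀} = 0`
      unfold DvocReduced.Phi at h
      rw [nsq_embS W, div_eq_zero_iff] at h
      rcases h with h | h
      · have := pow_pos (hv k₀) 2; nlinarith
      · exact absurd h (pow_ne_zero 2 (hne k₀))
    · -- `‖v_{k₀}‖ = 0`: then `v = 0`, excluded by the level
      exfalso
      rw [nsq_embS W] at h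
      have hab : a ^ 2 + b ^ 2 = 0 := by
        rcases mul_eq_zero.1 h with h' | h'
        · exact absurd h' (pow_ne_zero 2 (hne k₀))
        · exact h'
      have ha : a = 0 := by nlinarith [sq_nonneg a, sq_nonneg b]
      have hb : b = 0 := by nlinarith [sq_nonneg a, sq_nonneg b]
      rw [ha, hb, embS_zero W, V_zero W hne hΛ] at hV
      exact lt_irrefl _ hV
  intro k
  rw [nsq_embS W, hr, mul_one]

/-- **On `𝒮 ∩ 𝒜` the comparison function vanishes**: `ψ = 0` there (`‖v‖_S = 0` on `𝒮`,
`Φ_k = 0` when `‖v_k‖ = v_k*`). [cite: GrossEtAl2019, eq. (21)] -/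
theorem psi_eq_zero_of_mem_target (hΛ : W.Lam ≠ 0) (κ₀ : ℝ)
    {v : DvocState N} (hv : W.InS v ∧ ∀ k, dvocNsq v k = W.vref k ^ 2) : W.psi κ₀ v = 0 := by
  have h1 : W.normS2 v = 0 := (W.normS2_eq_zero_iff hΛ v).2 hv.1
  have h2 : ∑ k, W.Phi v k ^ 2 * dvocNsq v k = 0 :=
    Finset.sum_eq_zero fun k _ => by
      have : W.Phi v k = 0 := by unfold DvocReduced.Phi; rw [hv.2 k, sub_self, zero_div]
      simp [this]
  unfold DvocReduced.psi
  rw [h1, h2, Real.sqrt_zero]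
  ring

/-- **On `𝒮 ∩ 𝒜` the Lyapunov function vanishes** (lit-2's `V_eq_zero_iff`).
[cite: GrossEtAl2019, Prop. 3] -/
theorem V_eq_zero_of_mem_target (hne : ∀ k, W.vref k ≠ 0) (hΛ : W.Lam ≠ 0) {α₁ : ℝ}
    (hw : 0 < W.η * W.α * α₁) {v : DvocState N} (hv : W.InS v ∧ ∀ k, dvocNsq v k = W.vref k ^ 2) :
    W.V α₁ v = 0 :=
  (W.V_eq_zero_iff hΛ hw hne v).2 hv

/-- `𝒮 ∩ 𝒜` is nonempty: `S(1, 0)` (all converters at nominal magnitude, synchronous angles).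
[cite: GrossEtAl2019, §IV-D] -/
theorem embS_one_zero_mem_target :
    W.InS (W.embS 1 0) ∧ ∀ k, dvocNsq (W.embS 1 0) k = W.vref k ^ 2 :=
  ⟨⟨1, 0, rfl⟩, fun k => by rw [nsq_embS W]; ring⟩

end Summit.Ventures.GridStability.Lyapunov.DvocReducedRoa

end
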